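import Summits.BirchSwinnertonDyer.BirchSwinnertonDyer.Theorems.SmallImageMuTransferMuTransferStubX9LevelE
import Summits.BirchSwinnertonDyer.BirchSwinnertonDyer.Theorems.SmallImageMuTransferMuTransferStubX9GraphPairing
import HarnessLib

/-!
# K6 crux `MuTransfer` (stmt-BirchSwinnertonDyer-19629), stub `stub_x9`: THEOREM A of
# MU-TRANSFER-PROOF (KOLY-MEMO Thm. 5.7.1), Steps 1–4, as a kernel SCHEMA over its cohomological inputs

Cell `bsd-smallim`, seat `bsd-smallim-k6-c2` (D-0074 group (F)). HONEST FRAMING: theorems only (no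
definition, no named fact, D-0026); nothing is asserted about any curve and nothing is booked. Fourth
KERNEL file for the registered stub `stub_x9`. Theorem A ("`𝐳_1 ∉ p𝐇¹ ⟹ 𝒮 = Ш¹_S(ℚ, 𝒯^∨)` is
killed by `T^{2e−1}`, hence `𝐇²/p𝐇²` finite and `μ(𝐇²) = 0`") is proved in HOME/koly/MU-TRANSFER-PROOF.md
§5 by contradiction from a class `c ∈ 𝒮` of order `≥ J = 2e`. This file checks, in the kernel, that
THE FOUR STEPS ARE JOINTLY CONTRADICTORY once their cohomological outputs are on the table — i.e. the
LOGIC of §5 — with the algebra supplied by the sibling files (`…StubX9LevelE`: Step 4's count;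
`…StubX9GraphPairing`: Lemma 4 by polarisation) and the Galois-cohomological inputs as EXPLICIT
HYPOTHESES, each labelled by the step and the published tool it comes from (to be instantiated by the
typed finite-level / Λ-adic interface of seat `bsd-smallim-k6-ty`):

* STEP 1 (test classes; (F4), (F8), Lemma 3 (i) = `LevelE.shiftStable_submodule_eq_tPow`): the
  subspace `M = im(h, h^*) ≤ 𝒯_e × 𝒯_e^*` of joint values of the level-`e` classes `κ'_e` (from Kato's
  `𝐳̄_1 = T^a κ'`) and `y_e = T^e y` (from the bad class `c`), in `T`-adic coordinates
  (`𝒯_e = V^e`, `𝒯_e^* = V'^e`, `V = E[p]`, `V' = E[p]^*(1)`): stable under `γ − 1 = (T, ι(T))`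
  (`hM`, with `(Tx)_0 = 0`, `(Tx)_1 = x_0`, `(ι(T)y)_0 = 0`, `(ι(T)y)_1 = −y_0`) and with both
  projections onto (`h1`, `h2` — "`h mod T = res κ̄' ≠ 0` forces `im h = 𝒯_e`, `T^{e−1}h^* ≠ 0` forces
  `im h^* = 𝒯_e^*`"; the second is where `ord_T(c) ≥ J` enters).
* STEPS 2–3 (Chebotarev at level `e` in `L' = L_M(μ_{p^{m₀+1}})`, [Ch] + [Gou] + (F2); the Kolyvagin
  class `κ_q` of Lemma 2 from Kato's norm relation [K-13.3]; Lemma 1 at the `E`-split prime `q` of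
  depth `e_q = e`, (F5) = `LevelE.one_add_X_pow_sub_one_eq_X_pow_mul_unit`) and STEP 4 (reciprocity
  `Σ_v inv_v = 0` for `T^ε κ_q ∪ y`, [PT]/[LT], with `T^ε · loc_v y = 0` at `v ∈ S` by (F6) and the
  tame formula Lemma 1 (iii)): packaged as `hq` — for EVERY `(x, x^*) ∈ M` there are a prime `q` and
  lifts `k_1 ∈ 𝒯_J` of `x` (`= c'(Fr_q)`), `c_y(Fr_q) ∈ 𝒯_J^*` of `x^*`, a unit `U ∈ A_J`
  (`κ_q(σ̄) = U T^{e+a} k_1`) such that `T^ε · U · T^{e+a} · ⟨k_1, c_y(Fr_q)⟩_{A_J} = 0` in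
  `A_J = Ω/T^{2e}`; here the Gorenstein pairing `⟨·,·⟩_{A_J}` ((F7)/(4.2): coefficientwise convolution
  through `ev : V' × V → 𝔽_p`) enters only through its two lowest coefficients (`hpair0`, `hpair1`), and
  "`= 0` in `A_J`" is divisibility by `T^{2e}` in `Ω = k⟦T⟧`.
* THE LEVEL: `e ≥ a + ε + 2`, `e ≥ 2` (`he`, `he2`); `p ≠ 2` (`h2`); `ev` non-degenerate (`hev`).

`theoremA_contradiction_schema`: these hypotheses are contradictory. Proof = §5 verbatim: Lemma 4
(`LevelE.exists_mem_pairingCoeff_ne_zero`) picks `(x, x^*) ∈ M` with `v_T⟨x, x^*⟩_{A_e} ≤ 1`; the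
lifts of `hq` have a pairing with the same two lowest coefficients ((F7): coefficients of index `< e`
depend only on the truncations), so `T² ∤ ⟨k_1, c_y(Fr)⟩`; Step 4's count
(`LevelE.step4_contradiction`) finishes. What this schema does NOT contain is precisely the list of
its hypotheses: they are the typed-interface obligations (Kato 13.3 norm relations mod `p`,
Chebotarev, local/global duality at finite level), recorded here with their sources.

References: HOME/koly/MU-TRANSFER-PROOF.md §§1–5; K. Kato, Astérisque 295 (2004) §13.3, Thm. 12.4
[Kato2004Asterisque]; B. Mazur, K. Rubin, Mem. AMS 799 (2004) Prop. 1.3.2, §4.4 (prototype of the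
count).
-/

-- the summit and its single problem are both named `BirchSwinnertonDyer` (registry layout D-0017)
set_option linter.dupNamespace false

set_option autoImplicit false

namespace Summit.BirchSwinnertonDyer.BirchSwinnertonDyer.Rank1Residual.LevelE

open PowerSeries

variable {k : Type*} [Field k] {V V' : Type*} [AddCommGroup V] [Module k V] [AddCommGroup V']
  [Module k V']

/-- **THEOREM A (MU-TRANSFER-PROOF §5 = KOLY-MEMO Thm. 5.7.1), Steps 1–4 as a kernel schema: the
cohomological outputs of the four steps are jointly contradictory.** See the module docstring for the
dictionary hypothesis ↔ step ↔ published tool. In words: if a class `c ∈ Ш¹_S(ℚ, 𝒯^∨)` of order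
`≥ 2e` existed at a level `e ≥ a + ε + 2`, the joint-value module `M` of `(κ'_e, y_e)` would be
`(T, ι(T))`-stable with both projections onto (Step 1), so (Lemma 4, polarisation) some
`(x, x^*) ∈ M` pairs with `T`-valuation `ν ≤ 1`; a Chebotarev prime `q` of depth `e` realising
`(x, x^*)` as Frobenius values and the Kolyvagin class `κ_q` then give, by reciprocity,
`T^ε·U·T^{e+a}·⟨k_1, c_y(Fr_q)⟩ = 0` in `Ω/T^{2e}` with `⟨k_1, c_y(Fr_q)⟩ ≡ ⟨x, x^*⟩ (mod T^e)` of
valuation `ν` (Steps 2–4) — impossible since `ε + e + a + ν ≤ 2e − 1`.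
[cite: Kato2004Asterisque, §13.3 and Thm. 12.4 (the inputs 𝐳 and 𝐇¹)] -/
theorem theoremA_contradiction_schema (h2 : (2 : k) ≠ 0) {e a ε : ℕ} (he2 : 2 ≤ e)
    (he : a + ε + 2 ≤ e)
    -- the evaluation pairing `E[p]^*(1) × E[p] → μ_p ≅ 𝔽_p`, non-degenerate
    (ev : V' →ₗ[k] V →ₗ[k] k) (hev : ∃ (y : V') (v : V), ev y v ≠ 0)
    -- STEP 1: the joint-value module of the level-`e` classes, `(T, ι(T))`-stable, both projections onto
    (T : (Fin e → V) →ₗ[k] (Fin e → V)) (D : (Fin e → V') →ₗ[k] (Fin e → V'))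
    (hT0 : ∀ x, T x ⟨0, by omega⟩ = 0) (hT1 : ∀ x, T x ⟨1, by omega⟩ = x ⟨0, by omega⟩)
    (hD0 : ∀ y, D y ⟨0, by omega⟩ = 0) (hD1 : ∀ y, D y ⟨1, by omega⟩ = -y ⟨0, by omega⟩)
    (M : Submodule k ((Fin e → V) × (Fin e → V')))
    (hM : ∀ z ∈ M, (T z.1, D z.2) ∈ M)
    (h1 : ∀ v : V, ∃ z ∈ M, z.1 ⟨0, by omega⟩ = v)
    (h2' : ∀ y : V', ∃ z ∈ M, z.2 ⟨0, by omega⟩ = y)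
    -- the Gorenstein pairing `𝒯_J × 𝒯_J^* → A_J ↪ quotients of Ω = k⟦T⟧`, through its two lowest coefficients
    (pair : (Fin (2 * e) → V) → (Fin (2 * e) → V') → k⟦X⟧)
    (hpair0 : ∀ kk cc, coeff 0 (pair kk cc) = ev (cc ⟨0, by omega⟩) (kk ⟨0, by omega⟩))
    (hpair1 : ∀ kk cc, coeff 1 (pair kk cc) =
      ev (cc ⟨0, by omega⟩) (kk ⟨1, by omega⟩) + ev (cc ⟨1, by omega⟩) (kk ⟨0, by omega⟩))
    -- STEPS 2–4: for every joint value, a Chebotarev prime `q` of depth `e`, the lifts `k_1 = c'(Fr_q)`,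
    -- `c_y(Fr_q)`, the unit `U` of the Kolyvagin class `κ_q(σ̄) = U T^{e+a} k_1`, and reciprocity
    (hq : ∀ z ∈ M, ∃ (k1 : Fin (2 * e) → V) (cy : Fin (2 * e) → V') (U : k⟦X⟧), IsUnit U ∧
      (∀ i : Fin e, k1 ⟨i.val, by omega⟩ = z.1 i) ∧ (∀ i : Fin e, cy ⟨i.val, by omega⟩ = z.2 i) ∧
      (X : k⟦X⟧) ^ (2 * e) ∣ X ^ ε * U * X ^ (e + a) * pair k1 cy) :
    False := by
  -- Step 1 + Lemma 4: a joint value pairing with valuation ≤ 1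
  obtain ⟨z, hz, hν⟩ := exists_mem_pairingCoeff_ne_zero h2 he2 ev hev T D hT0 hT1 hD0 hD1 M hM h1 h2'
  -- Steps 2–3: the Chebotarev prime and the Kolyvagin class at it
  obtain ⟨k1, cy, U, hU, hk1, hcy, hrec⟩ := hq z hz
  -- (F7): the two lowest coefficients of `⟨k_1, c_y(Fr)⟩_{A_J}` are those of `⟨x, x^*⟩_{A_e}`
  have hc : ¬ (X : k⟦X⟧) ^ 2 ∣ pair k1 cy := by
    intro hdvd
    have h0 : coeff 0 (pair k1 cy) = 0 := by
      obtain ⟨r, hr⟩ := hdvd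
      rw [hr, pow_two, mul_assoc, coeff_zero_X_mul]
    have h1' : coeff 1 (pair k1 cy) = 0 := by
      obtain ⟨r, hr⟩ := hdvd
      rw [hr, pow_two, mul_assoc, coeff_succ_X_mul, coeff_zero_X_mul]
    rw [hpair0, hcy ⟨0, by omega⟩, hk1 ⟨0, by omega⟩] at h0
    rw [hpair1, hcy ⟨0, by omega⟩, hk1 ⟨1, by omega⟩, hcy ⟨1, by omega⟩, hk1 ⟨0, by omega⟩] at h1'
    rcases hν with hν0 | hν1
    · exact hν0 h0
    · exact hν1 h1'
  -- Step 4: the count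
  exact step4_contradiction hU hc he hrec

/-! ### Step 2's disjointness `Gal(L'/L₀) = M × ℤ/p` — from the scalar of (F2), no Goursat needed -/

/-- **MU-TRANSFER-PROOF §5 Step 2, the "[Gou]" sentence, kernel-checked in a stronger and simpler
form.** Let `L ≤ M × A` be a subspace projecting onto both factors and stable under an operator
acting as a scalar `λ ≠ 1` on the first factor and trivially on the second — in the memo: the image of
`Gal(L'/L₀) ↪ M × ℤ/p`, which is stable under conjugation by the central element `z₀ = (λ̄·1, ω̃(λ̄²))`
of (F8) (it acts on `𝒯_e ⊕ 𝒯_e^* ⊇ M` as the scalar `λ̄ ≠ 1` of (F2) and trivially on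
`Gal(L₀(μ_{p^{m₀+1}})/L₀) ≅ ℤ/p`). Then `L` is everything: `(λ − 1)(m, 0) = z₀·(m,a) − (m,a) ∈ L`.
So the Jordan–Hölder/Goursat argument of Step 2 reduces to the existence of the scalar. [folklore] -/
theorem eq_top_of_scalar_stable {M A : Type*} [AddCommGroup M] [Module k M] [AddCommGroup A]
    [Module k A] (L : Submodule k (M × A)) {c : k} (hc : c ≠ 1)
    (hz : ∀ z ∈ L, (c • z.1, z.2) ∈ L)
    (h1 : ∀ m : M, ∃ z ∈ L, z.1 = m) (h2 : ∀ a : A, ∃ z ∈ L, z.2 = a) : L = ⊤ := by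
  have hc1 : c - 1 ≠ 0 := sub_ne_zero.mpr hc
  -- `M × 0 ≤ L`
  have hM : ∀ m : M, ((m, 0) : M × A) ∈ L := by
    intro m
    obtain ⟨z, hz', rfl⟩ := h1 m
    have hdiff : ((c • z.1, z.2) : M × A) - z ∈ L := L.sub_mem (hz z hz') hz'
    have heq : ((c • z.1, z.2) : M × A) - z = ((c - 1) • z.1, 0) := by
      ext <;> simp [sub_smul]
    rw [heq] at hdiff
    have := L.smul_mem (c - 1)⁻¹ hdiff
    rwa [Prod.smul_mk, smul_zero, inv_smul_smul₀ hc1] at this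
  rw [eq_top_iff]
  rintro ⟨m, a⟩ -
  obtain ⟨z, hzL, rfl⟩ := h2 a
  have : ((m, z.2) : M × A) = (m - z.1, 0) + z := by ext <;> simp
  rw [this]
  exact L.add_mem (hM _) hzL

end Summit.BirchSwinnertonDyer.BirchSwinnertonDyer.Rank1Residual.LevelE
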